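import Summits.QuantumFields.YangMills.Theorems.AlphaInputsT3ACMinimiserPinRows
import Summits.QuantumFields.YangMills.Theorems.AlphaInputsT3ACv3DataSchema
import HarnessLib

/-!
# `AlphaInputsT3ACMinimiserPinTriv` — LANE B's DISPLAYED ROW (D5) `AlphaInputsT3AC.TrivMinimiserRowsT3` (seat alpha-2, `AlphaInputsT3ACv3DataSchema`) IS A THEOREM
# FROM [Balaban1985Variational] THM 1 IN THE TREE's GLOBAL READING (`T3PrintedMinimiserExistence.Thm1GlobalMinAt`) AND CONSTANTS SIDE CONDITIONS —
# lane `pub-balaban3d`, seat alpha-1 (g6; owner ruling g20 DEDUP: lane A owns the trivial-history pin)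

Cell `ym3-torus`, route `UnitScaleTilt`, crux 2′ `stub_laneRecordsV3` (stmt-QuantumFields-19936 ∕ -19935), strategy B.  Lane B's schema
`DataSchemaT3AC F 𝔠 a₀ a₁` displays, per `(γ, K)`, `∃ Ut, TrivMinimiserRowsT3 F 𝔠 γ hγ hγ1 a₀ a₁ K Ut ∧ DataRowsT3 … Ut`: a MEASURABLE trivial-history family with
`Ut 0 = id`, the record's row r1 ([7] Thm 1 + Prop 7, global reading) and the trivial-history instances of r2 ((42) top) and r3 ((68) multi-level) for
charged data.  THIS FILE: `trivMinimiserRowsT3_of_thm1GlobalMinAt` — such a `Ut` EXISTS as soon as `Thm1GlobalMinAt F.L a₀ a₁ 𝔠.B₃` holds (the [7] schema the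
19200 lanes attack, displayed verbatim) together with explicit CONSTANTS side conditions, all free for the record's exhibition of `𝔠`: print's «`a₁` small» in the
letters of [Balaban1985Averaging] (53) for the radius `2B₃a₁`; the (40) windows INSIDE the shell (`2L²·avgWindowFactor(L)·θBal(K−k+1) ≤ a₁`, a smallness of `γ₀`); the
located (N1)-type domination `2B₃·(2L²·avgWindowFactor(L)·θBal(K−k+1))·L^{−2(k−i)} ≤ C68·θBal(K−i)` (`i ≤ k ≤ K`; `C68` free upward); `1 ≤ 2B₃`.  It is the composition of
the seat's `…MinimiserPin` (existence: one minimiser per datum for the whole `(ε₁, ε₀)`-shell, Cantor intersection), `…MinimiserPinMeasurable` (Castaing selection) and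
`…MinimiserPinRows` (fibre identity and Prop. 2 along the pin; the rows' texts at `Hist.triv`, `Carriers.Omega_triv`).
HONEST FRAMING.  Kernel theorem about the tree's own objects; `Thm1GlobalMinAt` stays DISPLAYED (NOT proved here; its located half G-K1aR-2 included); (D5) is thereby
print's [7] Theorem 1 and nothing bespoke.  No `def`, no `instance`, no `sorry`; count-neutral; not a claim about the continuum limit or the mass gap.
References: T. Bałaban, Commun. Math. Phys. 102 (1985) 277–309 [Balaban1985Variational], Thm 1 (6)–(8) pp. 278–279; Commun. Math. Phys. 102 (1985) 255–275
[Balaban1985UV3], (40)–(42) p. 266, (68) p. 273; Commun. Math. Phys. 98 (1985) 17–51 [Balaban1985Averaging], Prop. 2 (52)–(54) p. 26.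
-/

set_option autoImplicit false

noncomputable section

namespace Summit.QuantumFields.YangMills.Theorems

open MeasureTheory
open scoped Matrix.Norms.L2Operator
open Literature.MathematicalPhysics.QuantumFieldTheory.Balaban1983to89
open Literature.MathematicalPhysics.QuantumFieldTheory.Balaban1983to89.T3ContinuumYM3Torus
open Literature.MathematicalPhysics.QuantumFieldTheory.Balaban1983to89.T3UnitScaleTilt (θBal)
open Literature.MathematicalPhysics.QuantumFieldTheory.Balaban1983to89.T3MinimiserStabilityReduction (θBal_pos)
open Literature.MathematicalPhysics.QuantumFieldTheory.Balaban1983to89.T3PrintedMinimiserExistence (Thm1GlobalMinAt)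
open Literature.MathematicalPhysics.QuantumFieldTheory.Balaban1983to89.ExpMeanLog (deltaSU)
open Summit.QuantumFields.Balaban3D.Carriers
open Summit.QuantumFields.Balaban3D.Proofs.Primitives

/-- The lane's window factor `L² + 6(5L)²` is positive. [cite: Balaban1985Averaging, Prop. 1 (51) p.26 (bookkeeping)] -/
theorem avgWindowFactor_pos (F : T3Family) : 0 < avgWindowFactor F.L := by
  have hL : (0 : ℝ) < (F.L : ℝ) := by have := F.hL.2; exact_mod_cast (by omega : 0 < F.L)
  unfold avgWindowFactor
  have h1 : (0 : ℝ) < (F.L : ℝ) ^ 2 := pow_pos hL 2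
  have h2 : (0 : ℝ) ≤ 6 * ((((3 + 2) * F.L : ℕ) : ℝ)) ^ 2 := by positivity
  linarith

/-- ★★ **(D5) FROM [7] THEOREM 1.**  For a member `F` of the d = 3 family, lane constants `𝔠`, a coupling `γ` of the record's window, [7] constants `(a₀, a₁)` with
`Thm1GlobalMinAt F.L a₀ a₁ 𝔠.B₃` (DISPLAYED), `B₃a₁ ≤ a₀`, and the constants side conditions of the module docstring, there is a trivial-history minimiser family
`Ut` with lane B's displayed row `AlphaInputsT3AC.TrivMinimiserRowsT3 F 𝔠 γ hγ hγ1 a₀ a₁ K Ut` (measurable, `Ut 0 = id`, r1, r2∕r3 at `Hist.triv`).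
[cite: Balaban1985Variational, Thm 1 (6)–(8) pp.278–279; Balaban1985UV3, (40)–(42) p.266 and (68) p.273; Balaban1985Averaging, Prop. 2 (52)–(54) p.26] -/
theorem AlphaInputsT3AC.trivMinimiserRowsT3_of_thm1GlobalMinAt (F : T3Family) (𝔠 : AlphaConsts F.L (suGroupModel 2).N) (γ : ℝ) (hγ : 0 < γ)
    (hγ1 : γ ≤ (min 𝔠.gamma0 1) ^ 2) {a₀ a₁ : ℝ} (K : ℕ) (hT : Thm1GlobalMinAt F.L a₀ a₁ 𝔠.B₃) (hwin : 𝔠.B₃ * a₁ ≤ a₀)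
    (hA3 : (143 * ((((3 + 4 : ℕ) : ℝ)) ^ 2 / 4) ^ 2) * (2 * (𝔠.B₃ * a₁)) ≤ 1 / 3)
    (hA2 : 2 * (2 * (𝔠.B₃ * a₁)) ≤ 2 * deltaSU (Fin 2) / (((3 + 4) * F.L : ℕ) : ℝ) ^ 2)
    (hB₃ : 1 ≤ 2 * 𝔠.B₃)
    (hwa : ∀ k, k ≤ K → 2 * (F.L : ℝ) ^ 2 * avgWindowFactor F.L * θBal F.L γ 𝔠.b₀ 𝔠.p₀ (K - k + 1) ≤ a₁)
    (hC68 : ∀ k i, i ≤ k → k ≤ K →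
      2 * 𝔠.B₃ * (2 * (F.L : ℝ) ^ 2 * avgWindowFactor F.L * θBal F.L γ 𝔠.b₀ 𝔠.p₀ (K - k + 1)) * (((F.L : ℝ) ^ (k - i))⁻¹) ^ 2 ≤
        𝔠.C68 * θBal F.L γ 𝔠.b₀ 𝔠.p₀ (K - i)) :
    ∃ Ut : (k : ℕ) → GaugeField (F.P K) k (Matrix.specialUnitaryGroup (Fin 2) ℂ) → GaugeField (F.P K) 0 (Matrix.specialUnitaryGroup (Fin 2) ℂ),
      AlphaInputsT3AC.TrivMinimiserRowsT3 F 𝔠 γ hγ hγ1 a₀ a₁ K Ut := by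
  have hγ1' : γ ≤ 1 := hγ1.trans (sq_min_one_le _ 𝔠.gamma0_pos)
  have hL1 : 1 ≤ F.L := by have := F.hL.2; omega
  -- `a₁ > 0`: the level-`K` window is positive and lies inside the shell
  have ha₁ : 0 < a₁ := by
    have hw : 0 < 2 * (F.L : ℝ) ^ 2 * avgWindowFactor F.L * θBal F.L γ 𝔠.b₀ 𝔠.p₀ (K - K + 1) := by
      have := θBal_pos hL1 hγ hγ1' 𝔠.b₀_pos 𝔠.p₀ (K - K + 1)
      have := avgWindowFactor_pos F
      have hL : (0 : ℝ) < (F.L : ℝ) := by exact_mod_cast (by omega : 0 < F.L)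
      positivity
    exact hw.trans_le (hwa K le_rfl)
  obtain ⟨Ut, hmeas, h0, hr1, hfib, hlev⟩ :=
    MinimiserPin.exists_measurable_pinnedFamily_rows F hT 𝔠.B₃_pos hwin hA3 hA2 K
  refine ⟨Ut, h0, hmeas, hr1, ?_, ?_⟩
  · -- r2 at the trivial history: the pin is a point of the descent fibre
    intro k _ hk W hch b hb
    exact MinimiserPin.row2_triv_of_fibreId F Ut γ 𝔠.b₀ 𝔠.p₀ (avgWindowFactor F.L) 𝔠.lane.carrier.M₁
      (rcolOf (T3Scales F γ hγ (hγ1.trans (sq_min_one_le _ 𝔠.gamma0_pos)) K) 𝔠.lane.carrier) ha₁ hfib hwa k hk W hch.2 b hb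
  · -- r3 at the trivial history: Prop. 2 along the pin, then the `C68`-domination
    intro k _ hk W hch i hi s hs q hq
    exact MinimiserPin.row3_triv_of_levelBound F Ut γ 𝔠.b₀ 𝔠.p₀ (avgWindowFactor F.L) 𝔠.C68 𝔠.lane.carrier.M₁
      (rcolOf (T3Scales F γ hγ (hγ1.trans (sq_min_one_le _ 𝔠.gamma0_pos)) K) 𝔠.lane.carrier) hγ hγ1' 𝔠.b₀_pos (avgWindowFactor_pos F) hB₃
      h0 hlev hwa hC68 k hk W hch.2 i hi s hs q hq

end Summit.QuantumFields.YangMills.Theorems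

end
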